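import Summits.Ventures.HodgeRepro2.T6B1Construct

/-!
# T6B1Anisotropic — `V(τ) = W α` is anisotropic over `E` (Tier-6 sub-goal B1, proof lane; supporting)

TIER4 B1.4 «Anisotropy»: a non-zero vector of `W α = (E³, diag(1, 1, α))` has non-zero norm, because at a real place
`w ≠ τ` the form is positive definite (`α_w > 0`, `θ_w < 0`). This is the mechanism behind the compactness of the ball
quotients (DR15, BMM §1.1); Liu prints projectivity in the Compact Case directly, so this file is supporting, not
load-bearing for `B1_main`.
-/

namespace Summit.Ventures.HodgeRepro2.T6
namespace B1Anisotropic

open NumberField B1Carriers B1Local B1Construct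
open scoped ComplexConjugate

variable (K : Type*) [Field K]

/-- The hermitian form of a diagonal Gram matrix: `(x, y) = Σ_i star(x_i) d_i y_i`. -/
theorem hermForm_diagonal {R : Type*} [CommRing R] [StarRing R] {n : ℕ} (d : Fin n → R) (x y : Fin n → R) :
    hermForm (Matrix.diagonal d) x y = ∑ i, star (x i) * (d i * y i) := by
  unfold hermForm
  refine Finset.sum_congr rfl fun i _ => ?_
  rw [Finset.sum_eq_single i]
  · rw [Matrix.diagonal_apply_eq, mul_assoc]
  · intro j _ hji
    rw [Matrix.diagonal_apply_ne _ (Ne.symm hji), mul_zero, zero_mul]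
  · intro h; exact absurd (Finset.mem_univ i) h

/-- `realExtToComplex t` carries `star` to complex conjugation when `t < 0`. -/
theorem realExtToComplex_star {t : ℝ} (ht : t < 0) (z : Ext ℝ t) :
    realExtToComplex t (star z) = conj (realExtToComplex t z) := by
  simp only [realExtToComplex_apply, QuadraticAlgebra.re_star, QuadraticAlgebra.im_star, csqrt, if_neg (not_le.2 ht),
    zero_mul, add_zero, map_add, map_mul, Complex.conj_ofReal, Complex.conj_I, Complex.ofReal_neg]
  ring

/-- `realExtToComplex t` is injective when `t < 0`. -/
theorem realExtToComplex_injective {t : ℝ} (ht : t < 0) : Function.Injective (realExtToComplex t) := by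
  refine (injective_iff_map_eq_zero _).2 fun z hz => ?_
  simp only [realExtToComplex_apply, csqrt, if_neg (not_le.2 ht)] at hz
  have hre := congrArg Complex.re hz
  have him := congrArg Complex.im hz
  simp only [Complex.add_re, Complex.ofReal_re, Complex.mul_re, Complex.I_re, Complex.ofReal_im, Complex.mul_im,
    Complex.I_im, Complex.add_im, Complex.zero_re, Complex.zero_im] at hre him
  have hs : Real.sqrt (-t) ≠ 0 := (Real.sqrt_pos.2 (by linarith)).ne'
  have him' : z.im = 0 := by
    have : z.im * Real.sqrt (-t) = 0 := by linarith
    exact (mul_eq_zero.1 this).resolve_right hs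
  have hre' : z.re = 0 := by rw [him'] at hre; linarith
  exact QuadraticAlgebra.ext hre' him'

/-- `globalToComplex` carries `star` to complex conjugation at a real place where `θ_w < 0`. -/
theorem globalToComplex_star (θ : K) {w : InfinitePlace K} (hw : w.IsReal) (hθw : realOf K hw θ < 0) (z : Ext K θ) :
    globalToComplex K θ hw (star z) = conj (globalToComplex K θ hw z) := by
  unfold globalToComplex
  rw [RingHom.comp_apply, RingHom.comp_apply, ← realExtToComplex_star hθw]
  congr 1
  refine QuadraticAlgebra.ext ?_ ?_
  · simp [extMap_apply]
  · simp [extMap_apply]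

/-- `globalToComplex` is injective at a real place where `θ_w < 0`. -/
theorem globalToComplex_injective (θ : K) {w : InfinitePlace K} (hw : w.IsReal) (hθw : realOf K hw θ < 0) :
    Function.Injective (globalToComplex K θ hw) := by
  unfold globalToComplex
  rw [RingHom.coe_comp]
  refine (realExtToComplex_injective hθw).comp ?_
  intro z z' h
  simp only [extMap_apply, QuadraticAlgebra.mk.injEq] at h
  refine QuadraticAlgebra.ext ?_ ?_
  · exact realOf_injective K hw h.1
  · exact realOf_injective K hw h.2

/-- A global hermitian space whose Gram matrix is diagonal with entries from `K` that are positive at some real place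
`w` with `θ_w < 0` is anisotropic. -/
theorem isAnisotropic_of_diagonal_pos [NumberField K] (θ : K) {n : ℕ} (d : Fin n → K)
    (W : GlobalHermitianSpace K θ n) (hW : W.gram = Matrix.diagonal (fun i => algebraMap K (Ext K θ) (d i)))
    {w : InfinitePlace K} (hw : w.IsReal) (hθw : realOf K hw θ < 0) (hd : ∀ i, 0 < realOf K hw (d i)) :
    IsAnisotropic K W := by
  intro x hx
  rw [hW, hermForm_diagonal] at hx
  have h := congrArg (globalToComplex K θ hw) hx
  rw [map_sum, map_zero] at h
  simp only [map_mul, globalToComplex_star K θ hw hθw, globalToComplex_algebraMap] at h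
  -- the real part of each term is `d_i(w) · |z_i|²`
  have hterm : ∀ i, (conj (globalToComplex K θ hw (x i)) * ((realOf K hw (d i) : ℂ) * globalToComplex K θ hw (x i))).re
      = realOf K hw (d i) * Complex.normSq (globalToComplex K θ hw (x i)) := by
    intro i
    rw [mul_left_comm, ← Complex.normSq_eq_conj_mul_self, ← Complex.ofReal_mul, Complex.ofReal_re]
  have hsum : ∑ i, realOf K hw (d i) * Complex.normSq (globalToComplex K θ hw (x i)) = 0 := by
    have := congrArg Complex.re h
    rw [Complex.re_sum, Complex.zero_re] at this
    simpa [hterm] using this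
  have hzero := (Finset.sum_eq_zero_iff_of_nonneg (fun i _ => mul_nonneg (hd i).le (Complex.normSq_nonneg _))).1 hsum
  funext i
  have hi := hzero i (Finset.mem_univ i)
  rcases mul_eq_zero.1 hi with h0 | h0
  · exact absurd h0 (hd i).ne'
  · have : globalToComplex K θ hw (x i) = 0 := Complex.normSq_eq_zero.1 h0
    rw [← map_zero (globalToComplex K θ hw)] at this
    exact globalToComplex_injective K θ hw hθw this

/-- **TIER4 B1.4, anisotropy.** `W α` is anisotropic as soon as some real place `w` has `θ_w < 0` and `α_w > 0`
(in `B1_main`: every real place `w ≠ τ`). -/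
theorem isAnisotropic_W [NumberField K] (θ : K) {α : K} (hα : α ≠ 0) {w : InfinitePlace K} (hw : w.IsReal)
    (hθw : realOf K hw θ < 0) (hαw : 0 < realOf K hw α) : IsAnisotropic K (W K θ hα) := by
  refine isAnisotropic_of_diagonal_pos K θ ![1, 1, α] (W K θ hα) ?_ hw hθw ?_
  · rw [W_gram]
    congr 1
    funext i
    fin_cases i <;> simp [wDiag]
  · intro i
    fin_cases i
    · simp [realOf]
    · simp [realOf]
    · simpa using hαw

end B1Anisotropic
end Summit.Ventures.HodgeRepro2.T6
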